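import Summits.CriticalPhenomena.PercolationContinuityZ3.Theorems.FK.PressureFieldDerivative
import Summits.CriticalPhenomena.PercolationContinuityZ3.Theorems.FK.MagnetizationDifferentiabilityCriterion
import HarnessLib

/-!
# THE SUSCEPTIBILITY IS THE SECOND FIELD-DERIVATIVE OF THE PRESSURE: `∂⁺(∂ψ/∂h)(β,h) = β² σ²(β,h)` at every `h > 0`
# (Ellis 2006, Lemma V.7.4 / eq. (5.28): «χ(β,h) = −∂²ψ/∂h² = β·σ²(β,h)», right-derivative form, without Lee–Yang)

Claimed R42 (8)(c) in the cell INBOX at 2026-08-28T22:45:16Z by fkp-10a gen 356 (NEW CLAIM #2 of the gen), addressed to coordinator fk-4 gen 283 (seated 21:31Z 2026-08-28 by l.8554; R157 in force); lineage row FO-10a-g356p (self-suggested), package g356-pressure, label PD-D.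
Helper file of the `fk-continuity` build cell (bschramm lane; `--supports stmt-CriticalPhenomena-4575`); builds on
p205010 (kernel theorem, internal audit signed; external expert review pending). No definitions, no named facts, no
sorries; standard axioms. UNCONDITIONAL (nearest-neighbour Ising model on `ℤ^d`, `d ≥ 1`).

Combining `PressureFieldDerivative` (`∂ψ/∂h = β m(β,h)` on `(0,∞)`) with the fluctuation–response theorem of
`MagnetizationFieldDerivative` (`∂⁺m/∂h = β σ²(β,h)`) and the differentiability criterion of
`MagnetizationDifferentiabilityCriterion`: for `β > 0`, `h > 0`, with `σ²(β,h) = Σ'_z (⟨σ_{{0}∆{z}}⟩⁺ − ⟨σ_0⟩⁺⟨σ_z⟩⁺)`,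

* **`hasDerivWithinAt_deriv_pressure_Ici`** — `∂ψ/∂h` has RIGHT derivative `β² σ²(β,h)` at every `h > 0` (Ellis (5.28)
  for the second right derivative; in Ellis's sign convention `ψ_Ellis = −ψ`);
* `hasDerivAt_deriv_pressure_of_continuousAt` — where `σ²(β,·)` is continuous, `ψ(β,·)` is twice differentiable with
  `ψ'' = β² σ²`; **`differentiableAt_deriv_pressure_iff`** — `∂ψ/∂h` is differentiable at `h > 0` iff `σ²(β,·)` is
  continuous at `h`; `countable_not_differentiableAt_deriv_pressure` — so `ψ(β,·)` is `C²` off a countable subset of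
  `(0,∞)`;
* `deriv_deriv_pressure_eq` — wherever it exists, `ψ''(h) = β² σ²(β,h)`.

## References

* R. S. Ellis, *Entropy, Large Deviations, and Statistical Mechanics*, Springer (1985/2006), Lemma V.7.4, eq. (5.28),
  eq. (5.25). [Ellis2006]
* S. Friedli, Y. Velenik, *Statistical Mechanics of Lattice Systems*, CUP (2017), §3.7.4 eq. (3.67), Exercise 3.34. [FriedliVelenik2017]
-/

noncomputable section

namespace Summit.CriticalPhenomena.PercolationContinuityZ3.Theorems.FK

namespace IsingSusceptibility

open MeasureTheory Filter Topology Finset Set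
open scoped symmDiff
open Literature.Probability.LatticeModels
open Summit.CriticalPhenomena.PercolationContinuityZ3.Theorems.FK.IsingCLT

variable {d : ℕ}

/-- Near every `h > 0` the field-derivative of the pressure IS `β m(β,·)` (as functions, eventually in `𝓝 h`).
[cite: FriedliVelenik2017, Cor. 3.44] -/
theorem deriv_pressure_eventuallyEq (hd : 1 ≤ d) {β : ℝ} (hβ : 0 ≤ β) {h : ℝ} (hh : 0 < h) :
    deriv (fun t => pressure d β t) =ᶠ[𝓝 h] fun t => β * magnetizationInField d β t := by
  filter_upwards [Ioi_mem_nhds hh] with t ht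
  exact deriv_pressure_field hd hβ ht

/-- **ELLIS (5.28), RIGHT-DERIVATIVE FORM: `∂⁺(∂ψ/∂h)(β,h) = β² σ²(β,h)` AT EVERY `h > 0`** (`d ≥ 1`, `β > 0`): the
field-derivative `β m(β,·)` of the pressure has right derivative `β · β σ²(β,h)` (the fluctuation–response theorem
`hasDerivWithinAt_magnetizationInField_Ici_of_pos`). [cite: Ellis2006, Lemma V.7.4, eq. (5.28)] -/
theorem hasDerivWithinAt_deriv_pressure_Ici (hd : 1 ≤ d) {β h : ℝ} (hβ : 0 < β) (hh : 0 < h) :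
    HasDerivWithinAt (deriv fun t => pressure d β t)
      (β * (β * ∑' z : Site d, (plusCorr d β h ({0} ∆ {z}) - plusCorr d β h {0} * plusCorr d β h {z}))) (Ici h) h := by
  have hm := (hasDerivWithinAt_magnetizationInField_Ici_of_pos (d := d) hβ hh).const_mul β
  refine hm.congr_of_eventuallyEq ?_ (deriv_pressure_field hd hβ.le hh)
  exact (deriv_pressure_eventuallyEq hd hβ.le hh).filter_mono nhdsWithin_le_nhds

/-- **`ψ'' = β² σ²` where `σ²(β,·)` is continuous**: at such `h > 0` the pressure is twice differentiable in the field.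
[cite: Ellis2006, Lemma V.7.4, eq. (5.28)] -/
theorem hasDerivAt_deriv_pressure_of_continuousAt (hd : 1 ≤ d) {β h : ℝ} (hβ : 0 < β) (hh : 0 < h)
    (hc : ContinuousAt
      (fun y => ∑' z : Site d, (plusCorr d β y ({0} ∆ {z}) - plusCorr d β y {0} * plusCorr d β y {z})) h) :
    HasDerivAt (deriv fun t => pressure d β t)
      (β * (β * ∑' z : Site d, (plusCorr d β h ({0} ∆ {z}) - plusCorr d β h {0} * plusCorr d β h {z}))) h := by
  have hm := (hasDerivAt_magnetizationInField_of_continuousWithinAt (d := d) hβ hh hc.continuousWithinAt).const_mul β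
  exact hm.congr_of_eventuallyEq (deriv_pressure_eventuallyEq hd hβ.le hh)

/-- **`∂ψ/∂h` IS DIFFERENTIABLE AT `h > 0` IFF `σ²(β,·)` IS CONTINUOUS AT `h`** (`d ≥ 1`, `β > 0`): the second
field-derivative of the pressure exists exactly where the susceptibility sum does not jump.
[cite: Ellis2006, Lemma V.7.4; FriedliVelenik2017, §3.7.4] -/
theorem differentiableAt_deriv_pressure_iff (hd : 1 ≤ d) {β h : ℝ} (hβ : 0 < β) (hh : 0 < h) :
    DifferentiableAt ℝ (deriv fun t => pressure d β t) h ↔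
      ContinuousAt (fun y => ∑' z : Site d, (plusCorr d β y ({0} ∆ {z}) - plusCorr d β y {0} * plusCorr d β y {z})) h := by
  rw [← differentiableAt_magnetizationInField_iff_continuousAt hβ hh,
    (deriv_pressure_eventuallyEq hd hβ.le hh).differentiableAt_iff]
  constructor
  · intro hdiff
    have := hdiff.const_mul β⁻¹
    simp only [← mul_assoc, inv_mul_cancel₀ hβ.ne', one_mul] at this
    exact this
  · intro hdiff
    exact hdiff.const_mul β

/-- **`ψ(β,·)` IS `C²` OFF A COUNTABLE SET OF FIELDS**: the set of `h > 0` where `∂ψ/∂h` is not differentiable is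
countable (`d ≥ 1`, `β > 0`). [cite: Ellis2006, Lemma V.7.4; Rockafellar1970, Thm. 25.3] -/
theorem countable_not_differentiableAt_deriv_pressure (hd : 1 ≤ d) {β : ℝ} (hβ : 0 < β) :
    Set.Countable {h : ℝ | 0 < h ∧ ¬ DifferentiableAt ℝ (deriv fun t => pressure d β t) h} := by
  refine (countable_not_differentiableAt_magnetizationInField (d := d) hβ).mono ?_
  intro h hh
  refine ⟨hh.1, fun hm => hh.2 ?_⟩
  rw [differentiableAt_deriv_pressure_iff hd hβ hh.1]
  exact (differentiableAt_magnetizationInField_iff_continuousAt hβ hh.1).1 hm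

/-- **Wherever the second derivative exists, `ψ''(β,h) = β² σ²(β,h)`** (`h > 0`). [cite: Ellis2006, eq. (5.28)] -/
theorem deriv_deriv_pressure_eq (hd : 1 ≤ d) {β h : ℝ} (hβ : 0 < β) (hh : 0 < h)
    (hdiff : DifferentiableAt ℝ (deriv fun t => pressure d β t) h) :
    deriv (deriv fun t => pressure d β t) h =
      β * (β * ∑' z : Site d, (plusCorr d β h ({0} ∆ {z}) - plusCorr d β h {0} * plusCorr d β h {z})) :=
  ConcaveLimit.deriv_eq_of_hasDerivWithinAt_Ioi
    ((hasDerivWithinAt_Ioi_iff_Ici).2 (hasDerivWithinAt_deriv_pressure_Ici hd hβ hh)) hdiff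

end IsingSusceptibility

end Summit.CriticalPhenomena.PercolationContinuityZ3.Theorems.FK

end
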